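import Summits.QuantumFields.BalabanUV.Beta.CombMixedT2EvenGradedRec
import Summits.QuantumFields.BalabanUV.Beta.CompositeMixedTableGradedCov
import Summits.QuantumFields.BalabanUV.Beta.CombMixedT2EvenStoreyPeriodised
import Summits.QuantumFields.BalabanUV.Beta.CombMixedT2EvenPeriodised

/-!
# `BalabanUV.Beta.CombMixedT2EvenGradedPeriodised` — binder row D1 ∕ (C1), PART 79b: **THE COARSE-SLOT-PERIODISED EVEN GRADED COMPOSITE MIXED TABLE OF ANY DEPTH `m` —
# LETTERS, SITE LAW, PERIOD COVARIANCE (`M = Lc^m·M′`), WINDOWS, AND THE FIRST-SLOT INDEX LAW IN THE ENGINE's `hlaw` SHAPE** (PART 33a `CombMixedT2EvenStoreyPeriodised` §1–§2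
# and PART 26 `CombMixedT2EvenPeriodised` §2 for (F0)'s `compMixG` in place of F6c's `compMix`; the `hlaw` is PART 78b's displayed commutator at the indicator `λ := δ_{w₀}` —
# contact kernel = the depth-`m` COMPOSITE Hessian `compH (ctrOff 4 Lc) Lc m`, NO root contact, NO remainder; consumed by PART 79c `CombMixedT2EvenGradedTorus`)

WHY (journal [AN2-G81-LANDED-2] INTENT-2; J-NOTE-26 §6 (2)).  PART 78b (p738031) proved the lattice law: the graded kernel's finest pure-gauge row in its background bond is the
single finest commutator `(λ(x_{f′}) − λ(x_f))·compVHKer ℓ 𝒽 Lc m` at EVERY depth.  At `λ := δ_{w₀}` (unsummed by parts with GAN24 `tsum_sum_dz_mul_eq`) this is a per-SITE index law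
of exactly the shape the row's period-lattice engine `CombWilsonT2Periodised.sum_tgrad_mul_perZ_dper_of_indexLaw_periodCov` consumes; PART 79a (block covariance, supports) and
(F0)∕78a supply the engine's other letters (`hVt`, `hS`, `hT`, `hqS`) verbatim as PART 33a did for `compMix`.

WHAT (`d = 3`, centred root, any depth `m`, any box `M = Lc^m·M′`, weight `wM2 3 L₂ j` free; [folklore] re-indexing of finitely supported sums BY NAME; no `def`, no `def … : Prop`,
nothing cited, 0 sorry):
* §1 letters of `M2ᴳᵉ := ½•(M2Of 3 L₂ (compMixG (ctrOff 4 Lc) Lc m) j κ u ρ′ w + sgnK (trK (…)))` on `(inl, inl)`: entry (`compMixG_ctr_inl_inl`, `compMixedT2G_even_inl_inl`), the three windows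
  `winF (Lc^m) (wid Lc m)` (79a ∕ 78a supports), the cube letters `_of_not_mem_T ∕ _S`, joint block covariance (79a `compMixG_translate`), and **`sum_compMixedT2G_even_sub_inl_inl`**
  (THE SITE LAW): `Σ_κ (M2ᴳᵉ κ (w₀−e_κ) − M2ᴳᵉ κ w₀) x z (inl α) (inl γ) = ([x = w₀] − [z = w₀]) · (−wM2 · compVHKer ℓ 𝒽 Lc m ρ′ y (α,x) (γ,z))`.
* §2 the family `hV : V = fun κ u x z a c => Σ'_n M2ᴳᵉ κ u ρ′ (w + M′∘n) x z a c`: `summable_compMixedT2G_even_translate_inl_inl`, `compMixedT2Gper_even_periodCov`, the windows,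
  `dper_compH_inl_inl_eq_zero_of_not_mem` (`hqS`; leaf-02 `dper_apply_of_siteCov` with `compH_hHt`), **`sum_compMixedT2Gper_even_sub_inl_inl`** (the `hlaw`:
  `Σ_κ (V κ (w₀ − e_κ) − V κ w₀)|ff = ([x = w₀] − [z = w₀]) · ((−wM2) • dper M (compH (ctrOff 4 Lc) Lc m ρ′ w))|ff`).
WHAT THIS IS NOT: not the torus display (79c); not a statement about `compMix` (PART 33 stands); not v11's `hM₂′` (the road's); nothing of Bałaban's asserted, valued or discharged;
0 estimates; 0∕4 row-D1 binders (hW, hR, D1Tel, D1Rep); ROOT M‴ p325680 ∕ P5c ∕ D6 untouched; NOT (C1), NOT (T-ID), NOT D1, NEVER «G-an2-4 closed», NOT BetaPertH, NOT continuum,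
NOT Clay.

HONEST DEPENDENCY (page 1, mandatory): continuum YM on T⁴ ⇐ BetaPertH ∧ nine spine estimates (0/9 proved); BetaPertH ⇐ (D1) ∧ (D4) ∧ CAP+tail;
G-an2-4 gates asym, D1 and NE2/3/4.  HONEST FRAMING (cell contract, verbatim): «discharging `BetaPertH` makes Bałaban's UV stability UNCONDITIONAL —
a real constructive-QFT result; it is NOT the continuum limit and NOT the Clay problem.»  ABSOLUTE RULE (cell charter, verbatim): «No internally-minted
statement may enter as a cited fact. Every hypothesis is either kernel-proved in this package or a verbatim quotation of a PUBLISHED theorem with page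
reference. The manuscript(s) under audit are NOT citable for their own disputed steps — they are the thing under adjudication; programme-internal
(2001/route/tribunal) claims are never citable.»  Row D1 ∕ (C1) OWNER an2 (b2b-balaban-beta-an2) gen 81, 2026-08-29.  §1∕§2 = PART 33a §1∕§2 and PART 26 §2 with the graded letters
(same proofs); the site law is new (PART 78b at an indicator).  No existing file touched.
-/

noncomputable section

open scoped BigOperators

namespace Summit.QuantumFields.BalabanUV.Beta.CombMixedT2EvenGradedPeriodised

open Finset Matrix
open Literature.MathematicalPhysics.QuantumFieldTheory
open Literature.MathematicalPhysics.QuantumFieldTheory.Balaban1983to89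
open Literature.MathematicalPhysics.QuantumFieldTheory.Balaban1983to89.Beta
open B4TorusKernel.MultiPeriod (translate translate_apply)
open B6Lemma24Torus (pbox mem_pbox)
open ExpKernelCalculus (MKer shiftK)
open AffineAveraging (Site box toSite unitVec dz)
open AveragingContoursRooted (ctr ctrOff ctrOff_mem_box)
open AveragingHessianKernels (Bond Near)
open OneStepResolventKernel (Fib)
open BalabanStepW2 (M2Of wM2)
open Summit.QuantumFields.BalabanUV.Beta.TameKernelCalculus (trK trK_apply)
open Summit.QuantumFields.BalabanUV.Beta.BorderedHessian (sgnK sgnK_apply sgnF_inl)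
open Summit.QuantumFields.BalabanUV.Beta.AxialDressingRooted (one_le_of_neZero)
open Summit.QuantumFields.BalabanUV.Beta.WardLocusParityLevels (M2Of_apply)
open Summit.QuantumFields.BalabanUV.Beta.SymAveragingHessianCounts (symLinKerAt symVhKerAt symHessKerAt)
open Summit.QuantumFields.BalabanUV.Beta.SymAveragingMixedJetTables (symMixKerAt)
open Summit.QuantumFields.BalabanUV.Beta.CompositeVertexKernelRec (offs winF wid compLinKer compVHKer compVHKer_eq_zero_left compVHKer_eq_zero_right)
open Summit.QuantumFields.BalabanUV.Beta.CompositeVertexKernelLiftKernel (mem_piFinset_of_mem_winF)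
open Summit.QuantumFields.BalabanUV.Beta.CompositeHessianTable (compHessFF_inl_inl)
open Summit.QuantumFields.BalabanUV.Beta.CompositeOneShotJets (compH compH_hHt)
open Summit.QuantumFields.BalabanUV.Beta.CompositeMixedTableGraded (compMixKerG compMixG)
open Summit.QuantumFields.BalabanUV.Beta.CompositeMixedTableGradedCov (compMixKerG_eq_zero_left compMixKerG_eq_zero_right compMixG_translate)
open Summit.QuantumFields.BalabanUV.Beta.CombMixedT2EvenGradedLetters (compMixKerG_eq_zero_bg)
open Summit.QuantumFields.BalabanUV.Beta.CombMixedT2EvenGradedRec (tsum_sum_grad_mul_compMixKerG_even)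
open Summit.QuantumFields.BalabanUV.Beta.CombMixedT2EvenStoreyTwoPeriodised (sub_mem_piFinset_of_mem_winF)
open Summit.QuantumFields.BalabanUV.Beta.GAN24.BorderGaugeLegContact (tsum_sum_dz_mul_eq)
open Summit.QuantumFields.BalabanUV.Beta.FP.KernelPeriodisationFib (Idx perF perF_apply perZ perZ_apply perZ_smul translate_eq_add)
open Summit.QuantumFields.BalabanUV.Beta.FP.KernelPeriodisationFibLoc (dper dper_apply)
open Summit.QuantumFields.BalabanUV.Beta.FP.TorusGaugeCovariance (tdelta tgrad)
open Summit.QuantumFields.BalabanUV.Beta.FP.TorusGaugeCovariancePairing (sum_tdelta_mul wrapPt_of_mem)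
open Summit.QuantumFields.BalabanUV.Beta.FP.PeriodisedBorderIndexWard (translate_injective)
open Summit.QuantumFields.BalabanUV.Beta.FP.PeriodisedBorderTables (translate_eq_add_smul)
open Summit.QuantumFields.BalabanUV.Beta.FP.PeriodisedBorderTablesRecord (dper_apply_of_siteCov)
open Summit.QuantumFields.BalabanUV.Beta.CombWilsonT2Periodised (sum_tgrad_mul_perZ_dper_of_indexLaw_periodCov translate_eq_translate_sub_add)

variable {Lc : ℕ} [NeZero Lc]

/-! ## §1 Letters of the even GRADED composite table of depth `m` on the `(inl, inl)` block -/

section Letters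

variable (L₂ j m : ℕ)

omit [NeZero Lc] in
/-- [folklore] the packed graded family's field–field entries ARE the graded kernel over an1's sym bricks at the centred root (`rfl`; `toSite (ctrOff 4 Lc) = ctr 4 Lc`). -/
theorem compMixG_ctr_inl_inl (κ : Fin (3 + 1)) (u : Site (3 + 1)) (ρ' : Fin (3 + 1)) (w x z : Site (3 + 1)) (α γ : Fin (3 + 1)) :
    compMixG (ctrOff (3 + 1) Lc) Lc m κ u ρ' w x z (Sum.inl α) (Sum.inl γ)
      = compMixKerG (fun _ => symLinKerAt (ctr 4 Lc) Lc) (fun _ => symVhKerAt (ctr 4 Lc) Lc) (fun _ => symHessKerAt (ctr 4 Lc) Lc)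
          (fun _ => symMixKerAt (ctr 4 Lc) Lc) Lc m ρ' w (κ, u) (α, x) (γ, z) := rfl

omit [NeZero Lc] in
/-- [folklore] **THE `(inl α, inl γ)` ENTRY OF THE EVEN GRADED TABLE** (depth `m`, weight index `j` at blocking `L₂`). -/
theorem compMixedT2G_even_inl_inl (κ : Fin (3 + 1)) (u : Site (3 + 1)) (ρ' : Fin (3 + 1)) (w x z : Site (3 + 1)) (α γ : Fin (3 + 1)) :
    ((1 / 2 : ℝ) • (M2Of 3 L₂ (compMixG (ctrOff (3 + 1) Lc) Lc m) j κ u ρ' w + sgnK (trK (M2Of 3 L₂ (compMixG (ctrOff (3 + 1) Lc) Lc m) j κ u ρ' w)))) x z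
        (Sum.inl α) (Sum.inl γ)
      = wM2 3 L₂ j * ((1 / 2 : ℝ)
          * (compMixKerG (fun _ => symLinKerAt (ctr 4 Lc) Lc) (fun _ => symVhKerAt (ctr 4 Lc) Lc) (fun _ => symHessKerAt (ctr 4 Lc) Lc)
                (fun _ => symMixKerAt (ctr 4 Lc) Lc) Lc m ρ' w (κ, u) (α, x) (γ, z)
            + compMixKerG (fun _ => symLinKerAt (ctr 4 Lc) Lc) (fun _ => symVhKerAt (ctr 4 Lc) Lc) (fun _ => symHessKerAt (ctr 4 Lc) Lc)
                (fun _ => symMixKerAt (ctr 4 Lc) Lc) Lc m ρ' w (κ, u) (γ, z) (α, x))) := by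
  simp only [Pi.smul_apply, Pi.add_apply, smul_eq_mul, sgnK_apply, trK_apply, sgnF_inl, M2Of_apply, one_mul, compMixG_ctr_inl_inl]
  ring

omit [NeZero Lc] in
/-- [folklore] LEFT-LEG WINDOW of the even graded table's `ff` entries (79a `compMixKerG_eq_zero_left ∕ _right`). -/
theorem compMixedT2G_even_inl_inl_eq_zero_of_left (κ : Fin (3 + 1)) (u : Site (3 + 1)) (ρ' : Fin (3 + 1)) (w : Site (3 + 1)) {x : Site (3 + 1)}
    (hx : x ∉ winF (Lc ^ m) (wid Lc m) w) (z : Site (3 + 1)) (α γ : Fin (3 + 1)) :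
    ((1 / 2 : ℝ) • (M2Of 3 L₂ (compMixG (ctrOff (3 + 1) Lc) Lc m) j κ u ρ' w + sgnK (trK (M2Of 3 L₂ (compMixG (ctrOff (3 + 1) Lc) Lc m) j κ u ρ' w)))) x z
        (Sum.inl α) (Sum.inl γ) = 0 := by
  rw [compMixedT2G_even_inl_inl, compMixKerG_eq_zero_left m (κ, u) (f := (α, x)) (γ, z) hx, compMixKerG_eq_zero_right m (κ, u) (γ, z) (f' := (α, x)) hx]
  ring

omit [NeZero Lc] in
/-- [folklore] RIGHT-LEG WINDOW. -/
theorem compMixedT2G_even_inl_inl_eq_zero_of_right (κ : Fin (3 + 1)) (u : Site (3 + 1)) (ρ' : Fin (3 + 1)) (w x : Site (3 + 1)) {z : Site (3 + 1)}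
    (hz : z ∉ winF (Lc ^ m) (wid Lc m) w) (α γ : Fin (3 + 1)) :
    ((1 / 2 : ℝ) • (M2Of 3 L₂ (compMixG (ctrOff (3 + 1) Lc) Lc m) j κ u ρ' w + sgnK (trK (M2Of 3 L₂ (compMixG (ctrOff (3 + 1) Lc) Lc m) j κ u ρ' w)))) x z
        (Sum.inl α) (Sum.inl γ) = 0 := by
  rw [compMixedT2G_even_inl_inl, compMixKerG_eq_zero_right m (κ, u) (α, x) (f' := (γ, z)) hz, compMixKerG_eq_zero_left m (κ, u) (f := (γ, z)) (α, x) hz]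
  ring

omit [NeZero Lc] in
/-- [folklore] FINE-BOND (family index) WINDOW (78a `compMixKerG_eq_zero_bg`). -/
theorem compMixedT2G_even_inl_inl_eq_zero_of_bond (κ : Fin (3 + 1)) {u : Site (3 + 1)} (ρ' : Fin (3 + 1)) (w : Site (3 + 1))
    (hu : u ∉ winF (Lc ^ m) (wid Lc m) w) (x z : Site (3 + 1)) (α γ : Fin (3 + 1)) :
    ((1 / 2 : ℝ) • (M2Of 3 L₂ (compMixG (ctrOff (3 + 1) Lc) Lc m) j κ u ρ' w + sgnK (trK (M2Of 3 L₂ (compMixG (ctrOff (3 + 1) Lc) Lc m) j κ u ρ' w)))) x z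
        (Sum.inl α) (Sum.inl γ) = 0 := by
  rw [compMixedT2G_even_inl_inl, compMixKerG_eq_zero_bg m (g := (κ, u)) (α, x) (γ, z) hu, compMixKerG_eq_zero_bg m (g := (κ, u)) (γ, z) (α, x) hu]
  ring

omit [NeZero Lc] in
/-- [folklore] the letter `hT` for every copy at once: zero unless the fine bond's site lies in the cube window `x − Π_i [−W_m, W_m]` of the LEFT fluctuation site. -/
theorem compMixedT2G_even_inl_inl_eq_zero_of_not_mem_T (κ : Fin (3 + 1)) (ρ' : Fin (3 + 1)) (y x z : Site (3 + 1)) (α γ : Fin (3 + 1)) :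
    ∀ u ∉ (Fintype.piFinset fun _ : Fin (3 + 1) => Finset.Icc (-(wid Lc m : ℤ)) (wid Lc m : ℤ)).image (fun v => x - v),
      ((1 / 2 : ℝ) • (M2Of 3 L₂ (compMixG (ctrOff (3 + 1) Lc) Lc m) j κ u ρ' y + sgnK (trK (M2Of 3 L₂ (compMixG (ctrOff (3 + 1) Lc) Lc m) j κ u ρ' y)))) x z
        (Sum.inl α) (Sum.inl γ) = 0 := fun u hu => by
  by_cases hx : x ∈ winF (Lc ^ m) (wid Lc m) y
  · exact compMixedT2G_even_inl_inl_eq_zero_of_bond L₂ j m κ ρ' y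
      (fun hu' => hu (Finset.mem_image.2 ⟨x - u, sub_mem_piFinset_of_mem_winF hx hu', sub_sub_cancel x u⟩)) x z α γ
  · exact compMixedT2G_even_inl_inl_eq_zero_of_left L₂ j m κ u ρ' y hx z α γ

omit [NeZero Lc] in
/-- [folklore] the letter `hS` for every copy at once: zero unless the RIGHT fluctuation site lies in the same cube window of the left one. -/
theorem compMixedT2G_even_inl_inl_eq_zero_of_not_mem_S (κ : Fin (3 + 1)) (u : Site (3 + 1)) (ρ' : Fin (3 + 1)) (y x : Site (3 + 1)) (α γ : Fin (3 + 1)) :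
    ∀ z ∉ (Fintype.piFinset fun _ : Fin (3 + 1) => Finset.Icc (-(wid Lc m : ℤ)) (wid Lc m : ℤ)).image (fun v => x - v),
      ((1 / 2 : ℝ) • (M2Of 3 L₂ (compMixG (ctrOff (3 + 1) Lc) Lc m) j κ u ρ' y + sgnK (trK (M2Of 3 L₂ (compMixG (ctrOff (3 + 1) Lc) Lc m) j κ u ρ' y)))) x z
        (Sum.inl α) (Sum.inl γ) = 0 := fun z hz => by
  by_cases hx : x ∈ winF (Lc ^ m) (wid Lc m) y
  · exact compMixedT2G_even_inl_inl_eq_zero_of_right L₂ j m κ u ρ' y x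
      (fun hz' => hz (Finset.mem_image.2 ⟨x - z, sub_mem_piFinset_of_mem_winF hx hz', sub_sub_cancel x z⟩)) α γ
  · exact compMixedT2G_even_inl_inl_eq_zero_of_left L₂ j m κ u ρ' y hx z α γ

omit [NeZero Lc] in
/-- [folklore] **JOINT BLOCK COVARIANCE OF THE EVEN GRADED TABLE** at blocking `Lc^m` (79a `compMixG_translate`; `sgnK`, `trK`, scalars commute with `shiftK`). -/
theorem compMixedT2G_even_translate (κ : Fin (3 + 1)) (u : Site (3 + 1)) (ρ' : Fin (3 + 1)) (w t x z : Site (3 + 1)) (a c : Fib 3) :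
    ((1 / 2 : ℝ) • (M2Of 3 L₂ (compMixG (ctrOff (3 + 1) Lc) Lc m) j κ (u + ((Lc ^ m : ℕ) : ℤ) • t) ρ' (w + t)
        + sgnK (trK (M2Of 3 L₂ (compMixG (ctrOff (3 + 1) Lc) Lc m) j κ (u + ((Lc ^ m : ℕ) : ℤ) • t) ρ' (w + t)))))
        (x + ((Lc ^ m : ℕ) : ℤ) • t) (z + ((Lc ^ m : ℕ) : ℤ) • t) a c
      = ((1 / 2 : ℝ) • (M2Of 3 L₂ (compMixG (ctrOff (3 + 1) Lc) Lc m) j κ u ρ' w + sgnK (trK (M2Of 3 L₂ (compMixG (ctrOff (3 + 1) Lc) Lc m) j κ u ρ' w)))) x z a c := by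
  simp only [Pi.smul_apply, Pi.add_apply, smul_eq_mul, sgnK_apply, trK_apply, M2Of_apply, compMixG_translate]
  simp only [shiftK, add_neg_cancel_right]

/-- [folklore] **`sum_compMixedT2G_even_sub_inl_inl` — THE SITE LAW OF THE EVEN GRADED TABLE** (PART 78b `tsum_sum_grad_mul_compMixKerG_even` AT THE INDICATOR `λ := δ_{w₀}`,
unsummed by parts with GAN24 `tsum_sum_dz_mul_eq`): for every coarse bond `(ρ′, y)`, site `w₀` and `ff` entry,
`Σ_κ (M2ᴳᵉ κ (w₀−e_κ) − M2ᴳᵉ κ w₀) x z (inl α) (inl γ) = ([x = w₀] − [z = w₀]) · (−wM2 · compVHKer ℓ 𝒽 Lc m ρ′ y (α,x) (γ,z))` — both fluctuation legs rotate at their own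
sites against the depth-`m` COMPOSITE Hessian; no root contact, no remainder. -/
theorem sum_compMixedT2G_even_sub_inl_inl (ρ' : Fin (3 + 1)) (y w₀ x z : Site (3 + 1)) (α γ : Fin (3 + 1)) :
    ∑ κ : Fin (3 + 1),
        (((1 / 2 : ℝ) • (M2Of 3 L₂ (compMixG (ctrOff (3 + 1) Lc) Lc m) j κ (w₀ - unitVec κ) ρ' y
            + sgnK (trK (M2Of 3 L₂ (compMixG (ctrOff (3 + 1) Lc) Lc m) j κ (w₀ - unitVec κ) ρ' y)))) x z (Sum.inl α) (Sum.inl γ)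
          - ((1 / 2 : ℝ) • (M2Of 3 L₂ (compMixG (ctrOff (3 + 1) Lc) Lc m) j κ w₀ ρ' y
            + sgnK (trK (M2Of 3 L₂ (compMixG (ctrOff (3 + 1) Lc) Lc m) j κ w₀ ρ' y)))) x z (Sum.inl α) (Sum.inl γ))
      = ((if x = w₀ then (1 : ℝ) else 0) - (if z = w₀ then 1 else 0))
          * (-wM2 3 L₂ j * compVHKer (fun _ => symLinKerAt (ctr 4 Lc) Lc) (fun _ => symHessKerAt (ctr 4 Lc) Lc) Lc m ρ' y (α, x) (γ, z)) := by
  simp only [compMixedT2G_even_inl_inl]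
  -- the even graded integrand as a function of the fine background bond
  set F : Fin (3 + 1) → Site (3 + 1) → ℝ := fun κ u => (1 / 2 : ℝ)
      * (compMixKerG (fun _ => symLinKerAt (ctr 4 Lc) Lc) (fun _ => symVhKerAt (ctr 4 Lc) Lc) (fun _ => symHessKerAt (ctr 4 Lc) Lc)
            (fun _ => symMixKerAt (ctr 4 Lc) Lc) Lc m ρ' y (κ, u) (α, x) (γ, z)
        + compMixKerG (fun _ => symLinKerAt (ctr 4 Lc) Lc) (fun _ => symVhKerAt (ctr 4 Lc) Lc) (fun _ => symHessKerAt (ctr 4 Lc) Lc)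
            (fun _ => symMixKerAt (ctr 4 Lc) Lc) Lc m ρ' y (κ, u) (γ, z) (α, x)) with hF
  have hFsum : ∀ κ (g : Site (3 + 1) → ℝ), Summable fun u => g u * F κ u := fun κ g =>
    summable_of_ne_finset_zero (s := winF (Lc ^ m) (wid Lc m) y) fun u hu => by
      rw [hF]
      beta_reduce
      rw [compMixKerG_eq_zero_bg m (g := (κ, u)) (α, x) (γ, z) hu, compMixKerG_eq_zero_bg m (g := (κ, u)) (γ, z) (α, x) hu, add_zero, mul_zero, mul_zero]
  -- PART 78b at the indicator of `w₀`, summed by parts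
  set lam : Site (3 + 1) → ℝ := fun v => if v = w₀ then (1 : ℝ) else 0 with hlam
  have h78 := tsum_sum_grad_mul_compMixKerG_even (Lc := Lc) lam m ρ' y (α, x) (γ, z)
  have hparts := tsum_sum_dz_mul_eq F hFsum lam
  simp only [dz] at hparts
  rw [show (∑' u : Site (3 + 1), ∑ κ : Fin (3 + 1), (lam (u + unitVec κ) - lam u) * F κ u)
      = ∑' u : Site (3 + 1), ∑ κ : Fin (3 + 1), (lam (u + unitVec κ) - lam u)
        * ((1 / 2 : ℝ) * (compMixKerG (fun _ => symLinKerAt (ctr 4 Lc) Lc) (fun _ => symVhKerAt (ctr 4 Lc) Lc) (fun _ => symHessKerAt (ctr 4 Lc) Lc)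
              (fun _ => symMixKerAt (ctr 4 Lc) Lc) Lc m ρ' y (κ, u) (α, x) (γ, z)
            + compMixKerG (fun _ => symLinKerAt (ctr 4 Lc) Lc) (fun _ => symVhKerAt (ctr 4 Lc) Lc) (fun _ => symHessKerAt (ctr 4 Lc) Lc)
              (fun _ => symMixKerAt (ctr 4 Lc) Lc) Lc m ρ' y (κ, u) (γ, z) (α, x))) from rfl, h78] at hparts
  -- the indicator picks the site `w₀`
  rw [tsum_eq_single w₀ (fun u hu => by rw [hlam]; beta_reduce; rw [if_neg hu, zero_mul])] at hparts
  simp only [hlam, if_true, one_mul] at hparts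
  -- `hparts : ([z = w₀] − [x = w₀])·compVHKer = Σ_κ (F κ (w₀−e_κ) − F κ w₀)`
  have hF' : ∀ κ u, F κ u = (1 / 2 : ℝ)
      * (compMixKerG (fun _ => symLinKerAt (ctr 4 Lc) Lc) (fun _ => symVhKerAt (ctr 4 Lc) Lc) (fun _ => symHessKerAt (ctr 4 Lc) Lc)
            (fun _ => symMixKerAt (ctr 4 Lc) Lc) Lc m ρ' y (κ, u) (α, x) (γ, z)
        + compMixKerG (fun _ => symLinKerAt (ctr 4 Lc) Lc) (fun _ => symVhKerAt (ctr 4 Lc) Lc) (fun _ => symHessKerAt (ctr 4 Lc) Lc)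
            (fun _ => symMixKerAt (ctr 4 Lc) Lc) Lc m ρ' y (κ, u) (γ, z) (α, x)) := fun κ u => rfl
  simp only [← hF']
  have hfac : (∑ κ : Fin (3 + 1), (wM2 3 L₂ j * F κ (w₀ - unitVec κ) - wM2 3 L₂ j * F κ w₀))
      = wM2 3 L₂ j * ∑ κ : Fin (3 + 1), (F κ (w₀ - unitVec κ) - F κ w₀) := by
    rw [Finset.mul_sum]
    simp only [mul_sub]
  rw [hfac, ← hparts]
  ring

end Letters

/-! ## §2 The coarse-slot-periodised even GRADED bi-family (depth `m`): copies, period covariance, windows, the `hlaw` -/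

section Family

variable {M M' : Fin (3 + 1) → ℕ} [∀ μ, NeZero (M μ)] [∀ μ, NeZero (M' μ)] (L₂ j m : ℕ) (ρ' : Fin (3 + 1)) (w : Site (3 + 1))
  {V : Fin (3 + 1) → Site (3 + 1) → MKer (3 + 1) (Fib 3)}

omit [∀ μ, NeZero (M μ)] in
/-- [folklore] summability of the COARSE-period copies on the `(inl, inl)` block (left-leg window; `n ↦ w + M′∘n` injective). -/
theorem summable_compMixedT2G_even_translate_inl_inl (κ : Fin (3 + 1)) (u x z : Site (3 + 1)) (α γ : Fin (3 + 1)) :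
    Summable fun n : Site (3 + 1) =>
      ((1 / 2 : ℝ) • (M2Of 3 L₂ (compMixG (ctrOff (3 + 1) Lc) Lc m) j κ u ρ' (translate M' w n)
          + sgnK (trK (M2Of 3 L₂ (compMixG (ctrOff (3 + 1) Lc) Lc m) j κ u ρ' (translate M' w n))))) x z (Sum.inl α) (Sum.inl γ) := by
  have hL : 0 < Lc ^ m := Nat.pos_of_ne_zero (NeZero.ne _)
  refine summable_of_ne_finset_zero
    (s := (Fintype.piFinset fun i => Finset.Icc ((x i - (wid Lc m : ℤ)) / ((Lc ^ m : ℕ) : ℤ)) (x i / ((Lc ^ m : ℕ) : ℤ))).preimage _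
      (translate_injective (M := M') w).injOn) fun n hn => ?_
  exact compMixedT2G_even_inl_inl_eq_zero_of_left L₂ j m κ u ρ' _ (fun hx => hn (Finset.mem_preimage.2 (mem_piFinset_of_mem_winF hL hx))) z α γ

omit [NeZero Lc] [∀ μ, NeZero (M μ)] [∀ μ, NeZero (M' μ)] in
/-- [folklore] **JOINT INVARIANCE UNDER THE PERIOD LATTICE OF `M = Lc^m·M′`** of `V κ u := Σ'_n M2ᴳᵉ κ u ρ′ (w + M′∘n)`. -/
theorem compMixedT2Gper_even_periodCov (hM : ∀ i, M i = Lc ^ m * M' i)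
    (hV : V = fun κ u x z a c => ∑' n : Site (3 + 1),
      ((1 / 2 : ℝ) • (M2Of 3 L₂ (compMixG (ctrOff (3 + 1) Lc) Lc m) j κ u ρ' (translate M' w n)
          + sgnK (trK (M2Of 3 L₂ (compMixG (ctrOff (3 + 1) Lc) Lc m) j κ u ρ' (translate M' w n))))) x z a c)
    (κ : Fin (3 + 1)) (u n₀ x z : Site (3 + 1)) (a c : Fib 3) :
    V κ (translate M u n₀) (translate M x n₀) (translate M z n₀) a c = V κ u x z a c := by
  subst hV
  show (∑' n : Site (3 + 1), ((1 / 2 : ℝ) • (M2Of 3 L₂ (compMixG (ctrOff (3 + 1) Lc) Lc m) j κ (translate M u n₀) ρ' (translate M' w n)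
          + sgnK (trK (M2Of 3 L₂ (compMixG (ctrOff (3 + 1) Lc) Lc m) j κ (translate M u n₀) ρ' (translate M' w n))))) (translate M x n₀) (translate M z n₀) a c)
      = ∑' n : Site (3 + 1), ((1 / 2 : ℝ) • (M2Of 3 L₂ (compMixG (ctrOff (3 + 1) Lc) Lc m) j κ u ρ' (translate M' w n)
          + sgnK (trK (M2Of 3 L₂ (compMixG (ctrOff (3 + 1) Lc) Lc m) j κ u ρ' (translate M' w n))))) x z a c
  rw [← (Equiv.subRight n₀).tsum_eq fun n => ((1 / 2 : ℝ) • (M2Of 3 L₂ (compMixG (ctrOff (3 + 1) Lc) Lc m) j κ u ρ' (translate M' w n)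
          + sgnK (trK (M2Of 3 L₂ (compMixG (ctrOff (3 + 1) Lc) Lc m) j κ u ρ' (translate M' w n))))) x z a c]
  refine tsum_congr fun n => ?_
  rw [Equiv.subRight_apply, translate_eq_add_smul hM u n₀, translate_eq_add_smul hM x n₀, translate_eq_add_smul hM z n₀,
    translate_eq_translate_sub_add M' w n n₀]
  exact compMixedT2G_even_translate L₂ j m κ u ρ' (translate M' w (n - n₀)) (fun i => (M' i : ℤ) * n₀ i) x z a c

omit [NeZero Lc] [∀ μ, NeZero (M μ)] [∀ μ, NeZero (M' μ)] in
/-- [folklore] window letter `hT` of the family. -/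
theorem compMixedT2Gper_even_inl_inl_eq_zero_of_not_mem_T
    (hV : V = fun κ u x z a c => ∑' n : Site (3 + 1),
      ((1 / 2 : ℝ) • (M2Of 3 L₂ (compMixG (ctrOff (3 + 1) Lc) Lc m) j κ u ρ' (translate M' w n)
          + sgnK (trK (M2Of 3 L₂ (compMixG (ctrOff (3 + 1) Lc) Lc m) j κ u ρ' (translate M' w n))))) x z a c)
    (κ : Fin (3 + 1)) (x z : Site (3 + 1)) (α γ : Fin (3 + 1)) :
    ∀ u ∉ (Fintype.piFinset fun _ : Fin (3 + 1) => Finset.Icc (-(wid Lc m : ℤ)) (wid Lc m : ℤ)).image (fun v => x - v),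
      V κ u x z (Sum.inl α) (Sum.inl γ) = 0 := fun u hu => by
  subst hV
  exact (tsum_congr fun n => compMixedT2G_even_inl_inl_eq_zero_of_not_mem_T L₂ j m κ ρ' _ x z α γ u hu).trans tsum_zero

omit [NeZero Lc] [∀ μ, NeZero (M μ)] [∀ μ, NeZero (M' μ)] in
/-- [folklore] window letter `hS` of the family. -/
theorem compMixedT2Gper_even_inl_inl_eq_zero_of_not_mem_S
    (hV : V = fun κ u x z a c => ∑' n : Site (3 + 1),
      ((1 / 2 : ℝ) • (M2Of 3 L₂ (compMixG (ctrOff (3 + 1) Lc) Lc m) j κ u ρ' (translate M' w n)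
          + sgnK (trK (M2Of 3 L₂ (compMixG (ctrOff (3 + 1) Lc) Lc m) j κ u ρ' (translate M' w n))))) x z a c)
    (κ : Fin (3 + 1)) (u x : Site (3 + 1)) (α γ : Fin (3 + 1)) :
    ∀ z ∉ (Fintype.piFinset fun _ : Fin (3 + 1) => Finset.Icc (-(wid Lc m : ℤ)) (wid Lc m : ℤ)).image (fun v => x - v),
      V κ u x z (Sum.inl α) (Sum.inl γ) = 0 := fun z hz => by
  subst hV
  exact (tsum_congr fun n => compMixedT2G_even_inl_inl_eq_zero_of_not_mem_S L₂ j m κ u ρ' _ x α γ z hz).trans tsum_zero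

omit [NeZero Lc] [∀ μ, NeZero (M μ)] [∀ μ, NeZero (M' μ)] in
/-- [folklore] the contact kernel's window (`hqS`): the COARSE-slot-periodised depth-`m` composite Hessian `dper M (compH (ctrOff 4 Lc) Lc m ρ′ w)` (`= Σ'_n compH … ρ′ (w + M′∘n)`,
leaf-02's `dper_apply_of_siteCov` with `compH_hHt`, `M = Lc^m·M′`) vanishes on `(inl, inl)` unless `z ∈ x − Π_i [−W_m, W_m]`; so does any scalar multiple. -/
theorem dper_compH_inl_inl_eq_zero_of_not_mem (hM : ∀ i, M i = Lc ^ m * M' i) (c : ℝ) (x : Site (3 + 1)) (α γ : Fin (3 + 1)) :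
    ∀ z ∉ (Fintype.piFinset fun _ : Fin (3 + 1) => Finset.Icc (-(wid Lc m : ℤ)) (wid Lc m : ℤ)).image (fun v => x - v),
      (c • dper M (compH (ctrOff (3 + 1) Lc) Lc m ρ' w)) x z (Sum.inl α) (Sum.inl γ) = 0 := fun z hz => by
  rw [Pi.smul_apply, Pi.smul_apply, Pi.smul_apply, Pi.smul_apply, smul_eq_mul,
    dper_apply_of_siteCov hM (fun ρ y t => compH_hHt (r := ctrOff (3 + 1) Lc) (L := Lc) m ρ y t) ρ' w x z (Sum.inl α) (Sum.inl γ)]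
  rw [(tsum_congr fun n => ?_).trans tsum_zero, mul_zero]
  simp only [compH, compHessFF_inl_inl]
  by_cases hx : x ∈ winF (Lc ^ m) (wid Lc m) (translate M' w n)
  · exact compVHKer_eq_zero_right m _ (f' := (γ, z))
      (fun hz' => hz (Finset.mem_image.2 ⟨x - z, sub_mem_piFinset_of_mem_winF hx hz', sub_sub_cancel x z⟩))
  · exact compVHKer_eq_zero_left m (f := (α, x)) _ hx

omit [∀ μ, NeZero (M μ)] in
/-- [folklore] **`sum_compMixedT2Gper_even_sub_inl_inl` — THE FIRST-SLOT INDEX LAW OF THE PERIODISED EVEN GRADED BI-FAMILY** in the engine's `hlaw` shape on the `(inl, inl)` block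
(`M = Lc^m·M′`): `Σ_κ (V κ (w₀ − e_κ) − V κ w₀) x z (inl α) (inl γ) = ([x = w₀] − [z = w₀]) · ((−wM2) • dper M (compH (ctrOff 4 Lc) Lc m ρ′ w)) x z (inl α) (inl γ)` — §1's site law for each
copy `w + M′∘n` of the multiplier bond, summed; `Σ'_n compH ρ′ (w + M′∘n) = dper M (compH ρ′ w)`. -/
theorem sum_compMixedT2Gper_even_sub_inl_inl (hM : ∀ i, M i = Lc ^ m * M' i)
    (hV : V = fun κ u x z a c => ∑' n : Site (3 + 1),
      ((1 / 2 : ℝ) • (M2Of 3 L₂ (compMixG (ctrOff (3 + 1) Lc) Lc m) j κ u ρ' (translate M' w n)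
          + sgnK (trK (M2Of 3 L₂ (compMixG (ctrOff (3 + 1) Lc) Lc m) j κ u ρ' (translate M' w n))))) x z a c)
    (w₀ x z : Site (3 + 1)) (α γ : Fin (3 + 1)) :
    ∑ κ : Fin (3 + 1), (V κ (w₀ - unitVec κ) x z (Sum.inl α) (Sum.inl γ) - V κ w₀ x z (Sum.inl α) (Sum.inl γ))
      = ((if x = w₀ then (1 : ℝ) else 0) - (if z = w₀ then 1 else 0))
          * (((-wM2 3 L₂ j) • dper M (compH (ctrOff (3 + 1) Lc) Lc m ρ' w)) x z (Sum.inl α) (Sum.inl γ)) := by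
  subst hV
  have hsum : ∀ κ : Fin (3 + 1),
      (∑' n : Site (3 + 1), ((1 / 2 : ℝ) • (M2Of 3 L₂ (compMixG (ctrOff (3 + 1) Lc) Lc m) j κ (w₀ - unitVec κ) ρ' (translate M' w n)
          + sgnK (trK (M2Of 3 L₂ (compMixG (ctrOff (3 + 1) Lc) Lc m) j κ (w₀ - unitVec κ) ρ' (translate M' w n))))) x z (Sum.inl α) (Sum.inl γ))
        - (∑' n : Site (3 + 1), ((1 / 2 : ℝ) • (M2Of 3 L₂ (compMixG (ctrOff (3 + 1) Lc) Lc m) j κ w₀ ρ' (translate M' w n)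
          + sgnK (trK (M2Of 3 L₂ (compMixG (ctrOff (3 + 1) Lc) Lc m) j κ w₀ ρ' (translate M' w n))))) x z (Sum.inl α) (Sum.inl γ))
      = ∑' n : Site (3 + 1), (((1 / 2 : ℝ) • (M2Of 3 L₂ (compMixG (ctrOff (3 + 1) Lc) Lc m) j κ (w₀ - unitVec κ) ρ' (translate M' w n)
          + sgnK (trK (M2Of 3 L₂ (compMixG (ctrOff (3 + 1) Lc) Lc m) j κ (w₀ - unitVec κ) ρ' (translate M' w n))))) x z (Sum.inl α) (Sum.inl γ)
          - ((1 / 2 : ℝ) • (M2Of 3 L₂ (compMixG (ctrOff (3 + 1) Lc) Lc m) j κ w₀ ρ' (translate M' w n)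
          + sgnK (trK (M2Of 3 L₂ (compMixG (ctrOff (3 + 1) Lc) Lc m) j κ w₀ ρ' (translate M' w n))))) x z (Sum.inl α) (Sum.inl γ)) := fun κ =>
    ((summable_compMixedT2G_even_translate_inl_inl (M' := M') L₂ j m ρ' w κ (w₀ - unitVec κ) x z α γ).tsum_sub
      (summable_compMixedT2G_even_translate_inl_inl (M' := M') L₂ j m ρ' w κ w₀ x z α γ)).symm
  simp only [hsum]
  rw [← Summable.tsum_finsetSum (fun κ _ => (summable_compMixedT2G_even_translate_inl_inl (M' := M') L₂ j m ρ' w κ (w₀ - unitVec κ) x z α γ).sub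
    (summable_compMixedT2G_even_translate_inl_inl (M' := M') L₂ j m ρ' w κ w₀ x z α γ))]
  -- the site law, copy by copy
  rw [tsum_congr fun n => sum_compMixedT2G_even_sub_inl_inl (Lc := Lc) L₂ j m ρ' (translate M' w n) w₀ x z α γ, tsum_mul_left]
  congr 1
  rw [Pi.smul_apply, Pi.smul_apply, Pi.smul_apply, Pi.smul_apply, smul_eq_mul,
    dper_apply_of_siteCov hM (fun ρ y t => compH_hHt (r := ctrOff (3 + 1) Lc) (L := Lc) m ρ y t) ρ' w x z (Sum.inl α) (Sum.inl γ), neg_mul, ← tsum_mul_left, ← tsum_neg]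
  refine tsum_congr fun n => ?_
  simp only [compH, compHessFF_inl_inl]
  rw [show ctr 4 Lc = toSite (ctrOff (3 + 1) Lc) from rfl]
  ring

end Family

end Summit.QuantumFields.BalabanUV.Beta.CombMixedT2EvenGradedPeriodised

end
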